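import Summits.HodgeConjecture.HodgeConjecture.Theorems.K2E5QuatAdelicMatrixModelDefs     -- ★ #3d (K2E5-p12): `quatModel σ H = {x | (σx)ᵀ H = H · adj x}`, `mem_quatModel_iff`
import Summits.HodgeConjecture.HodgeConjecture.Theorems.K2E5LieGramDetValueIndefinite     -- ★ (this seat) p855704∕p855738: `𝔲(2)`, `𝔲(1,1)` coordinates; brings ★ `skewC`, `traceFormC`, `mem_skewC_two_one`
import HarnessLib

/-!
# K2 ∕ E5 «TamagawaUnitary» — FILE `K2E5QuatArchTrdGram` (deal (18), K2E5-plan (g2) SWEEP #10e): THE ARCHIMEDEAN QUATERNION MODELS `D(1₂) = ℍ` AND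
# `D(J₋) ≅ M₂(ℝ)` INSIDE `M₂(ℂ)`, THEIR REDUCED-TRACE GRAM DETERMINANT `−16` (BOTH TYPES), AND «TRACELESS PART = 𝔰𝔲» — the Lie-level D-side twin of
# ★ `K2E5LieGramDetValue{,Indefinite}` behind the F9∞ constant `2^{−3}` per complex place

Cell `pub/hodgecm-mathlib`, Track B «K2-LIT», engine E5, crux H413 = `stmt-HodgeConjecture-24833`, route of record `route-HodgeConjecture-HCCMUnconditional`;
dealer K2E5-plan (g2) (SWEEP #10e 2026-09-03T23:53:09Z, deal (18) «GO L-Lie», after this seat's F9-D∞ census 23:52:49Z); prover seat hodgecm-mathlib-K2E5-p22 (g2).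
THEOREMS ONLY (no `def`, no `instance`, no `notation`, no named-fact hypothesis, no `sorry`); imports = ★ Theorems + HarnessLib; lane
`--supports stmt-HodgeConjecture-24833 --as helper`.  The arch D-side DEFINITIONS (`quatArchLocal`, `quatArchNrd`, `quatArchSelfDualHaar`, …) are the NEXT
file of the chain (`Theorems/K2E5QuatArchLocalDefs.lean`, definition lane); this file is the explicit matrix algebra they rest on.

THE MATHEMATICS.  At a complex place `w` of the CM field `L` (real place of `L⁺` below it) the quaternion algebra `D_h ⊗_{L⁺} ℝ` is the matrix model
★ `quatModel (starRingEnd ℂ) h_w = {x ∈ M₂(ℂ) | x̄ᵀ h_w = h_w · adj x}` (★ #3d, `h_w = σ_w(h)`); every non-degenerate hermitian `h_w` is congruent to `1₂`, `−1₂` (same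
model) or `J₋ = diag(1, −1)` (★ `conj_mem_quatModel` transports).  The two models are
* DEFINITE `D(1₂) = {!![u, v; −v̄, ū]} = ℍ` (§1: `mem_quatModel_conj_one`, `eq_of_mem_quatModel_conj_one`; `trd = 2 Re u`, `Nrd = det = |u|² + |v|²`),
* INDEFINITE `D(J₋) = {!![u, v; v̄, ū]} ≅ M₂(ℝ)` (§2: `mem_quatModel_conj_diag`, `eq_of_mem_quatModel_conj_diag`; `trd = 2 Re u`, `Nrd = det = |u|² − |v|²`),
with real coordinate bases `(1, I, J, K) = (1, diag(i,−i), !![0,1;−1,0], !![0,i;i,0])` resp. `(1, diag(i,−i), !![0,1;1,0], !![0,i;−i,0])` (`quatCoord_*_eq_sum`).  For the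
REAL trace form `β(x, y) = Re tr(xy)` (★ `traceFormC 2` — on `D_w` this IS the reduced-trace form `trd(xy)`, which is real there) the Gram matrices are
`diag(2, −2, −2, −2)` resp. `diag(2, −2, 2, 2)`, **determinant `−16` in BOTH types** (§1∕§2 `traceFormC_gram_*`, `det_traceFormC_gram_*`), so the trd-self-dual Lebesgue
measure of `D_w` is `4 · dp dq dr ds` in either coordinate system, and `trd = 2p` (`p = Re u`).  Finally the TRACELESS elements `qI + rJ + sK` are LITERALLY the
`𝔰𝔲`-coordinate matrices of ★ `K2E5LieGramDetValue{,Indefinite}` at `(a, b, z) = (q, −q, r + is)` (§1∕§2 `traceless_quatCoord_*`: `= !![iq, r+is; ∓(r−is), −iq] ∈ skewC 2 (1₂ ∕ J₋)`):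
`𝔰𝔩₁(D_w) = 𝔰𝔲(h_w)` inside `M₂(ℂ)`, and the quotient Lebesgue measures `(4 dp dq dr ds) ∕ trd^*(dt) = 2 dq dr ds` and `(2 da db d²z) ∕ tr^*(dt) = 2 da d²z` COINCIDE —
the Lie-level content of the F9∞ constant (`2^{−3}` per complex place = the Cayley-chart factor `2^{−4+1}` of the U-side top-form measures, nothing else;
this seat's census, K2 bus 2026-09-03T23:52:49Z, RISK R6 CLOSED by the dealer 23:53:09Z).

HONEST LABEL.  HC_CM is proved only modulo the 7 printed citations (2 remaining named inputs: hLiu418 = `stmt-HodgeConjecture-24832`, h413 = `stmt-HodgeConjecture-24833`)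
until rung 0 closes; this file moves no counter.

## References
* [VignerasLNM800] M.-F. Vignéras, *Arithmétique des algèbres de quaternions*, LNM 800, Springer (1980), Ch. I §1 (`M(2,K)`: `h̄ = adj h`, `n = det`, `t = tr`), Ch. III §1 (`X_ℝ = ℍ` or `M₂(ℝ)`).
* [Weil1982] A. Weil, *Adeles and algebraic groups*, Birkhäuser (1982), Ch. IV §4.4 p. 91 (hermitian planes and quaternion algebras).
* [Knapp2002] A. W. Knapp, *Lie Groups Beyond an Introduction*, 2nd ed. (2002), I §1 (`𝔰𝔲(2) = 𝔰𝔭(1) = Im ℍ`, `𝔰𝔲(1,1) ≅ 𝔰𝔩₂(ℝ)`).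
* [Macdonald1980] I. G. Macdonald, *The volume of a compact Lie group*, Invent. Math. 56 (1980), 93–95 (trace-form normalisation).
-/

set_option autoImplicit false
-- the mandated namespace repeats the single-problem summit's segment (`HodgeConjecture.HodgeConjecture`)
set_option linter.dupNamespace false

noncomputable section

open Matrix Complex
open scoped Matrix ComplexConjugate
open Summit.HodgeConjecture.HodgeConjecture.Cruxes.H413.K2E5QuatAdelicMatrixModel (quatModel mem_quatModel_iff)
open Literature.NumberTheory.Weil1964.UnitaryArchLocalTopForm
open Summit.HodgeConjecture.HodgeConjecture.Cruxes.H413.K2E5LieGramDetValueIndefinite (mem_skewC_two_diag)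

namespace Summit.HodgeConjecture.HodgeConjecture.Cruxes.H413.K2E5QuatArchTrdGram

/-! ## §1 The definite model `D(1₂) = ℍ = {!![u, v; −v̄, ū]}` -/

section Definite

/-- The coordinate matrices `!![u, v; −v̄, ū]` lie in the definite archimedean model `D(1₂) = {x | x̄ᵀ = adj x}`. [cite: VignerasLNM800, Ch. I §1; Ch. III §1] -/
theorem mem_quatModel_conj_one (u v : ℂ) :
    !![u, v; -conj v, conj u] ∈ quatModel (starRingEnd ℂ) (1 : Matrix (Fin 2) (Fin 2) ℂ) := by
  rw [mem_quatModel_iff, Matrix.adjugate_fin_two_of, Matrix.mul_one, Matrix.one_mul]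
  ext i j
  fin_cases i <;> fin_cases j <;> simp [Matrix.map_apply]

/-- Every element of `D(1₂)` is a coordinate matrix: `x = !![x₀₀, x₀₁; −x̄₀₁, x̄₀₀]`. [cite: VignerasLNM800, Ch. I §1; Ch. III §1] -/
theorem eq_of_mem_quatModel_conj_one {x : Matrix (Fin 2) (Fin 2) ℂ} (hx : x ∈ quatModel (starRingEnd ℂ) (1 : Matrix (Fin 2) (Fin 2) ℂ)) :
    x = !![x 0 0, x 0 1; -conj (x 0 1), conj (x 0 0)] := by
  rw [mem_quatModel_iff, Matrix.adjugate_fin_two, Matrix.mul_one, Matrix.one_mul] at hx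
  have h00 := congrFun (congrFun hx 0) 0
  have h10 := congrFun (congrFun hx 1) 0
  simp only [Matrix.transpose_apply, Matrix.map_apply, Fin.isValue, Matrix.of_apply, Matrix.cons_val', Matrix.cons_val_zero, Matrix.cons_val_one,
    Matrix.cons_val_fin_one] at h00 h10
  ext i j
  fin_cases i <;> fin_cases j
  · simp
  · simp
  · -- `(1,0)`: `conj x₀₁ = −x₁₀`
    simp only [Fin.mk_one, Fin.isValue, Fin.zero_eta, of_apply, cons_val', cons_val_zero, cons_val_one, cons_val_fin_one]
    rw [h10, neg_neg]
  · -- `(1,1)`: `conj x₀₀ = x₁₁`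
    simp only [Fin.mk_one, Fin.isValue, of_apply, cons_val', cons_val_one, cons_val_fin_one]
    exact h00.symm

/-- Reduced trace in coordinates: `tr !![u, v; −v̄, ū] = 2 Re u` (real). [cite: VignerasLNM800, Ch. I §1] -/
theorem trace_quatCoord_one (u v : ℂ) : Matrix.trace !![u, v; -conj v, conj u] = ((2 * u.re : ℝ) : ℂ) := by
  rw [Matrix.trace_fin_two_of, Complex.add_conj]

/-- Reduced norm in coordinates: `det !![u, v; −v̄, ū] = |u|² + |v|²` (real, the DEFINITE norm form of `ℍ`). [cite: VignerasLNM800, Ch. I §1; Ch. III §1] -/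
theorem det_quatCoord_one (u v : ℂ) : Matrix.det !![u, v; -conj v, conj u] = ((Complex.normSq u + Complex.normSq v : ℝ) : ℂ) := by
  rw [Matrix.det_fin_two_of, mul_neg, sub_neg_eq_add, Complex.mul_conj, Complex.mul_conj]
  push_cast
  ring

/-- The real coordinate basis `(1, I, J, K) = (1, diag(i,−i), !![0,1;−1,0], !![0,i;i,0])` of `D(1₂)`: `!![u, v; −v̄, ū] = Re u·1 + Im u·I + Re v·J + Im v·K`.
[cite: VignerasLNM800, Ch. I §1] [cite: Knapp2002, I §1] -/
theorem quatCoord_one_eq_sum (u v : ℂ) :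
    !![u, v; -conj v, conj u] =
      u.re • (1 : Matrix (Fin 2) (Fin 2) ℂ) + u.im • !![I, 0; 0, -I] + v.re • !![(0 : ℂ), 1; -1, 0] + v.im • !![0, I; I, 0] := by
  ext i j
  fin_cases i <;> fin_cases j <;> apply Complex.ext <;> simp

/-- **THE trd-GRAM MATRIX OF `D(1₂) = ℍ`**: for the basis `(1, I, J, K)` the Gram matrix of the real trace form `β(x,y) = Re tr(xy)` (★ `traceFormC 2`; `= trd(xy)` on `ℍ`)
is `diag(2, −2, −2, −2)`. [cite: VignerasLNM800, Ch. I §1] [cite: Macdonald1980, p. 93] -/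
theorem traceFormC_gram_one :
    Matrix.of (fun i j : Fin 4 =>
      traceFormC 2 (![(1 : Matrix (Fin 2) (Fin 2) ℂ), !![I, 0; 0, -I], !![(0 : ℂ), 1; -1, 0], !![0, I; I, 0]] i)
        (![(1 : Matrix (Fin 2) (Fin 2) ℂ), !![I, 0; 0, -I], !![(0 : ℂ), 1; -1, 0], !![0, I; I, 0]] j)) =
      Matrix.diagonal ![(2 : ℝ), -2, -2, -2] := by
  ext i j
  rw [Matrix.of_apply, traceFormC_apply]
  fin_cases i <;> fin_cases j <;> norm_num [Matrix.trace_fin_two, Matrix.diagonal, Matrix.one_apply, Matrix.mul_apply, Fin.sum_univ_two]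

/-- **THE trd-GRAM DETERMINANT OF `ℍ` IS `−16`** (so the trd-self-dual Lebesgue measure of `D_w` is `√16 = 4` times the `(1, I, J, K)`-coordinate Lebesgue measure).
[cite: VignerasLNM800, Ch. I §1; Ch. II §4] [cite: Macdonald1980, p. 93] -/
theorem det_traceFormC_gram_one :
    (Matrix.of (fun i j : Fin 4 =>
      traceFormC 2 (![(1 : Matrix (Fin 2) (Fin 2) ℂ), !![I, 0; 0, -I], !![(0 : ℂ), 1; -1, 0], !![0, I; I, 0]] i)
        (![(1 : Matrix (Fin 2) (Fin 2) ℂ), !![I, 0; 0, -I], !![(0 : ℂ), 1; -1, 0], !![0, I; I, 0]] j))).det = -16 := by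
  rw [traceFormC_gram_one, Matrix.det_diagonal]
  simp [Fin.prod_univ_four]
  norm_num

/-- **TRACELESS PART = `𝔰𝔲(2)`**: `qI + rJ + sK = !![iq, r + is; −(r − is), −iq]` — the `𝔲(2)`-coordinate matrix of ★ `K2E5LieGramDetValue` at `(a, b, z) = (q, −q, r + is)`,
an element of `skewC 2 1₂` (★ `mem_skewC_two_one`) with trace `0`: `𝔰𝔩₁(ℍ) = Im ℍ = 𝔰𝔲(2)` inside `M₂(ℂ)`. [cite: Knapp2002, I §1] [cite: VignerasLNM800, Ch. III §1] -/
theorem traceless_quatCoord_one (q r s : ℝ) :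
    q • !![I, 0; 0, -I] + r • !![(0 : ℂ), 1; -1, 0] + s • !![0, I; I, 0] =
      !![(q : ℂ) * I, (r : ℂ) + (s : ℂ) * I; -conj ((r : ℂ) + (s : ℂ) * I), ((-q : ℝ) : ℂ) * I] := by
  ext i j
  fin_cases i <;> fin_cases j <;> simp [Complex.conj_ofReal]
  ring

/-- The traceless coordinate matrices of `ℍ` lie in `𝔲(2) = skewC 2 1₂` (with diagonal coordinates `(q, −q)`). [cite: Knapp2002, I §1] -/
theorem traceless_quatCoord_one_mem_skewC (q r s : ℝ) :
    q • !![I, 0; 0, -I] + r • !![(0 : ℂ), 1; -1, 0] + s • !![0, I; I, 0] ∈ skewC 2 (1 : Matrix (Fin 2) (Fin 2) ℂ) := by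
  rw [traceless_quatCoord_one]
  exact mem_skewC_two_one q (-q) ((r : ℂ) + (s : ℂ) * I)

/-- The traceless coordinate matrices of `ℍ` have trace `0` (`trd(qI + rJ + sK) = 0`). [cite: VignerasLNM800, Ch. I §1] -/
theorem trace_traceless_quatCoord_one (q r s : ℝ) :
    Matrix.trace (q • !![I, 0; 0, -I] + r • !![(0 : ℂ), 1; -1, 0] + s • !![0, I; I, 0]) = 0 := by
  rw [traceless_quatCoord_one, Matrix.trace_fin_two_of]
  push_cast
  ring

end Definite

/-! ## §2 The indefinite model `D(J₋) = {!![u, v; v̄, ū]} ≅ M₂(ℝ)`, `J₋ = diag(1, −1)` -/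

section Indefinite

/-- The coordinate matrices `!![u, v; v̄, ū]` lie in the indefinite archimedean model `D(J₋) = {x | x̄ᵀ J₋ = J₋ · adj x}`. [cite: VignerasLNM800, Ch. I §1; Ch. III §1] -/
theorem mem_quatModel_conj_diag (u v : ℂ) :
    !![u, v; conj v, conj u] ∈ quatModel (starRingEnd ℂ) (Matrix.diagonal ![(1 : ℂ), -1]) := by
  rw [mem_quatModel_iff, Matrix.adjugate_fin_two_of]
  ext i j
  fin_cases i <;> fin_cases j <;> simp [Matrix.map_apply, Matrix.mul_apply, Matrix.diagonal]

/-- Every element of `D(J₋)` is a coordinate matrix: `x = !![x₀₀, x₀₁; x̄₀₁, x̄₀₀]`. [cite: VignerasLNM800, Ch. I §1; Ch. III §1] -/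
theorem eq_of_mem_quatModel_conj_diag {x : Matrix (Fin 2) (Fin 2) ℂ} (hx : x ∈ quatModel (starRingEnd ℂ) (Matrix.diagonal ![(1 : ℂ), -1])) :
    x = !![x 0 0, x 0 1; conj (x 0 1), conj (x 0 0)] := by
  rw [mem_quatModel_iff, Matrix.adjugate_fin_two] at hx
  have h00 := congrFun (congrFun hx 0) 0
  have h10 := congrFun (congrFun hx 1) 0
  simp only [Matrix.mul_apply, Fin.sum_univ_two, Matrix.transpose_apply, Matrix.map_apply, Matrix.diagonal, Fin.isValue, Matrix.of_apply,
    Matrix.cons_val', Matrix.cons_val_zero, Matrix.cons_val_one, Matrix.cons_val_fin_one] at h00 h10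
  norm_num at h00 h10
  ext i j
  fin_cases i <;> fin_cases j
  · simp
  · simp
  · -- `(1,0)`: `conj x₀₁ = x₁₀`
    simp only [Fin.mk_one, Fin.isValue, Fin.zero_eta, of_apply, cons_val', cons_val_zero, cons_val_one, cons_val_fin_one]
    exact h10.symm
  · -- `(1,1)`: `conj x₀₀ = x₁₁`
    simp only [Fin.mk_one, Fin.isValue, of_apply, cons_val', cons_val_one, cons_val_fin_one]
    exact h00.symm

/-- Reduced trace in coordinates: `tr !![u, v; v̄, ū] = 2 Re u` (real). [cite: VignerasLNM800, Ch. I §1] -/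
theorem trace_quatCoord_diag (u v : ℂ) : Matrix.trace !![u, v; conj v, conj u] = ((2 * u.re : ℝ) : ℂ) := by
  rw [Matrix.trace_fin_two_of, Complex.add_conj]

/-- Reduced norm in coordinates: `det !![u, v; v̄, ū] = |u|² − |v|²` (real, the INDEFINITE norm form — `D(J₋)` is split). [cite: VignerasLNM800, Ch. I §1; Ch. III §1] -/
theorem det_quatCoord_diag (u v : ℂ) : Matrix.det !![u, v; conj v, conj u] = ((Complex.normSq u - Complex.normSq v : ℝ) : ℂ) := by
  rw [Matrix.det_fin_two_of, Complex.mul_conj, Complex.mul_conj]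
  push_cast
  ring

/-- The real coordinate basis `(1, I, J′, K′) = (1, diag(i,−i), !![0,1;1,0], !![0,i;−i,0])` of `D(J₋)`: `!![u, v; v̄, ū] = Re u·1 + Im u·I + Re v·J′ + Im v·K′`.
[cite: VignerasLNM800, Ch. I §1] [cite: Knapp2002, I §1] -/
theorem quatCoord_diag_eq_sum (u v : ℂ) :
    !![u, v; conj v, conj u] =
      u.re • (1 : Matrix (Fin 2) (Fin 2) ℂ) + u.im • !![I, 0; 0, -I] + v.re • !![(0 : ℂ), 1; 1, 0] + v.im • !![0, I; -I, 0] := by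
  ext i j
  fin_cases i <;> fin_cases j <;> apply Complex.ext <;> simp

/-- **THE trd-GRAM MATRIX OF `D(J₋)`**: for the basis `(1, I, J′, K′)` the Gram matrix of `β(x,y) = Re tr(xy)` is `diag(2, −2, 2, 2)` (the split signature).
[cite: VignerasLNM800, Ch. I §1] [cite: Macdonald1980, p. 93] -/
theorem traceFormC_gram_diag :
    Matrix.of (fun i j : Fin 4 =>
      traceFormC 2 (![(1 : Matrix (Fin 2) (Fin 2) ℂ), !![I, 0; 0, -I], !![(0 : ℂ), 1; 1, 0], !![0, I; -I, 0]] i)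
        (![(1 : Matrix (Fin 2) (Fin 2) ℂ), !![I, 0; 0, -I], !![(0 : ℂ), 1; 1, 0], !![0, I; -I, 0]] j)) =
      Matrix.diagonal ![(2 : ℝ), -2, 2, 2] := by
  ext i j
  rw [Matrix.of_apply, traceFormC_apply]
  fin_cases i <;> fin_cases j <;> norm_num [Matrix.trace_fin_two, Matrix.diagonal, Matrix.one_apply, Matrix.mul_apply, Fin.sum_univ_two]

/-- **THE trd-GRAM DETERMINANT OF `D(J₋)` IS `−16`** — the SAME as for `ℍ`: the trd-self-dual Lebesgue measure of `D_w` is `4 ·` the coordinate Lebesgue measure at a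
definite AND at an indefinite place. [cite: VignerasLNM800, Ch. I §1; Ch. II §4] [cite: Macdonald1980, p. 93] -/
theorem det_traceFormC_gram_diag :
    (Matrix.of (fun i j : Fin 4 =>
      traceFormC 2 (![(1 : Matrix (Fin 2) (Fin 2) ℂ), !![I, 0; 0, -I], !![(0 : ℂ), 1; 1, 0], !![0, I; -I, 0]] i)
        (![(1 : Matrix (Fin 2) (Fin 2) ℂ), !![I, 0; 0, -I], !![(0 : ℂ), 1; 1, 0], !![0, I; -I, 0]] j))).det = -16 := by
  rw [traceFormC_gram_diag, Matrix.det_diagonal]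
  simp [Fin.prod_univ_four]
  norm_num

/-- **TRACELESS PART = `𝔰𝔲(1,1)`**: `qI + rJ′ + sK′ = !![iq, r + is; r − is, −iq]` — the `𝔲(J₋)`-coordinate matrix of ★ `K2E5LieGramDetValueIndefinite` at
`(a, b, z) = (q, −q, r + is)`: `𝔰𝔩₁(D(J₋)) = 𝔰𝔲(1,1)` inside `M₂(ℂ)`. [cite: Knapp2002, I §1] [cite: VignerasLNM800, Ch. III §1] -/
theorem traceless_quatCoord_diag (q r s : ℝ) :
    q • !![I, 0; 0, -I] + r • !![(0 : ℂ), 1; 1, 0] + s • !![0, I; -I, 0] =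
      !![(q : ℂ) * I, (r : ℂ) + (s : ℂ) * I; conj ((r : ℂ) + (s : ℂ) * I), ((-q : ℝ) : ℂ) * I] := by
  ext i j
  fin_cases i <;> fin_cases j <;> simp [Complex.conj_ofReal]

/-- The traceless coordinate matrices of `D(J₋)` lie in `𝔲(1,1) = skewC 2 J₋` (★ `mem_skewC_two_diag`, diagonal coordinates `(q, −q)`). [cite: Knapp2002, I §1] -/
theorem traceless_quatCoord_diag_mem_skewC (q r s : ℝ) :
    q • !![I, 0; 0, -I] + r • !![(0 : ℂ), 1; 1, 0] + s • !![0, I; -I, 0] ∈ skewC 2 (Matrix.diagonal ![(1 : ℂ), -1]) := by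
  rw [traceless_quatCoord_diag]
  exact mem_skewC_two_diag q (-q) ((r : ℂ) + (s : ℂ) * I)

/-- The traceless coordinate matrices of `D(J₋)` have trace `0`. [cite: VignerasLNM800, Ch. I §1] -/
theorem trace_traceless_quatCoord_diag (q r s : ℝ) :
    Matrix.trace (q • !![I, 0; 0, -I] + r • !![(0 : ℂ), 1; 1, 0] + s • !![0, I; -I, 0]) = 0 := by
  rw [traceless_quatCoord_diag, Matrix.trace_fin_two_of]
  push_cast
  ring

end Indefinite

end Summit.HodgeConjecture.HodgeConjecture.Cruxes.H413.K2E5QuatArchTrdGram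

end
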